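import Summits.Schanuel.Schanuel.Theorems.RootDecomp1KTwoBaseCell06

/-!
# RootDecomp1KTwoBaseCell — lens 1, generation 36 «TWO-BASE WALL CELL of 33364» (RootDecomp1KTwoBaseCell.lean f6aad3c3…, 1847 l) — continuation (RootDecomp1KTwoBaseCell07): §6 second half — the two-scale form bound for `(1, ℓ₂, ℓ₃)` (`form_lower_bound_W`, hypothesis-free)

(lens-1 g36 `RootDecomp1KTwoBaseCell.lean`, sha256 f6aad3c3…cd39, own farm rc 0 · 0 sorry · axioms std; critic VERDICT STATUS L1729 PORT GO LOW;
port by census-1 gen 15 in nine parts `RootDecomp1KTwoBaseCell01`–`09` — see the PORT NOTE of part 01; `--supports stmt-Schanuel-33364`; rung 0.)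
-/

noncomputable section

open Complex IntermediateField Polynomial
open Summit.Schanuel.Schanuel.Theorems.RootDecomp1KHyper
open Summit.Schanuel.Schanuel.Theorems.RootDecomp1KHyper.HyperCell
open Summit.Schanuel.Schanuel.Theorems.RootDecomp1KGeneric
open Summit.Schanuel.Schanuel.Theorems.RootDecomp1KRelLiouvilleCell
open Summit.Schanuel.Schanuel.Theorems.RootDecomp1KLogLogCell (LogLogLiouville logLogLiouville_of_logSqLiouville
  logLogLiouville_of_logHyperLiouville logLogLiouville_of_hyperLiouville)

namespace Summit.Schanuel.Schanuel.Theorems.RootDecomp1KTwoBaseCell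

open LiouvilleNumber
open scoped Nat

section FormBound
open LiouvilleNumber
open scoped Nat

/-- Upper bound for the tail in base `m ≥ 2`: `r_k ≤ 2·m^{-(k+1)!}`. -/
private theorem remainder_le {m : ℝ} (hm : 2 ≤ m) (k : ℕ) : remainder m k ≤ 2 / m ^ (k + 1)! := by
  have m1 : (1 : ℝ) < m := by linarith
  have m0 : (0 : ℝ) < m := by linarith
  have h := remainder_lt' k m1
  have hhalf : (1 : ℝ) / m ≤ 1 / 2 := one_div_le_one_div_of_le two_pos hm
  have hpos : (0 : ℝ) < 1 - 1 / m := by linarith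
  have hinv : (1 - 1 / m)⁻¹ ≤ 2 := by
    rw [inv_le_comm₀ hpos two_pos]
    linarith
  have hmk : (0 : ℝ) < 1 / m ^ (k + 1)! := by positivity
  calc remainder m k ≤ (1 - 1 / m)⁻¹ * (1 / m ^ (k + 1)!) := h.le
    _ ≤ 2 * (1 / m ^ (k + 1)!) := mul_le_mul_of_nonneg_right hinv hmk.le
    _ = 2 / m ^ (k + 1)! := by ring

/-- `2 ≤ e`. -/
private theorem two_le_exp_one : (2 : ℝ) ≤ Real.exp 1 := by
  have := Real.exp_one_gt_d9; linarith

/-- `6 ≤ e²`. -/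
private theorem six_le_exp_two : (6 : ℝ) ≤ Real.exp 2 := by
  have h : Real.exp 2 = Real.exp 1 ^ 2 := by rw [← Real.exp_nat_mul]; norm_num
  rw [h]
  have h1 := Real.exp_one_gt_d9
  calc (6 : ℝ) ≤ (2.7182818283 : ℝ) ^ 2 := by norm_num
    _ ≤ Real.exp 1 ^ 2 := pow_le_pow_left₀ (by norm_num) h1.le 2

set_option maxHeartbeats 800000 in

/-! ### The two-scale form bound for `(1, ℓ₂, ℓ₃)` -/

/-- Approximation at scale `K`: `|φ − Φ_K| ≤ 2H · 2^{−(K+1)!}`. -/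
private theorem form_approx (g : Fin 3 → ℤ) (K : ℕ) :
    |((g 0 : ℝ) + g 1 * liouvilleNumber 2 + g 2 * liouvilleNumber 3) -
      ((g 0 : ℝ) + g 1 * partialSum 2 K + g 2 * partialSum 3 K)| ≤
      2 * (∑ i, (|g i| : ℝ)) / 2 ^ (K + 1)! := by
  have h2 := partialSum_add_remainder (by norm_num : (1 : ℝ) < 2) K
  have h3 := partialSum_add_remainder (by norm_num : (1 : ℝ) < 3) K
  have r2le : remainder 2 K ≤ 2 / 2 ^ (K + 1)! := remainder_le (by norm_num) K
  have r3le : remainder 3 K ≤ 2 / 2 ^ (K + 1)! := by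
    refine (remainder_le (by norm_num) K).trans ?_
    gcongr; norm_num
  have r2pos := remainder_pos (by norm_num : (1 : ℝ) < 2) K
  have r3pos := remainder_pos (by norm_num : (1 : ℝ) < 3) K
  have e : ((g 0 : ℝ) + g 1 * liouvilleNumber 2 + g 2 * liouvilleNumber 3) -
      ((g 0 : ℝ) + g 1 * partialSum 2 K + g 2 * partialSum 3 K) =
      g 1 * remainder 2 K + g 2 * remainder 3 K := by rw [← h2, ← h3]; ring
  rw [e]
  have hsum : |(g 1 : ℝ)| + |(g 2 : ℝ)| ≤ ∑ i, (|g i| : ℝ) := by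
    rw [Fin.sum_univ_three]; linarith [abs_nonneg (g 0 : ℝ)]
  calc |(g 1 : ℝ) * remainder 2 K + g 2 * remainder 3 K|
      ≤ |(g 1 : ℝ)| * remainder 2 K + |(g 2 : ℝ)| * remainder 3 K := by
        refine (abs_add_le _ _).trans ?_
        rw [abs_mul, abs_mul, abs_of_pos r2pos, abs_of_pos r3pos]
    _ ≤ |(g 1 : ℝ)| * (2 / 2 ^ (K + 1)!) + |(g 2 : ℝ)| * (2 / 2 ^ (K + 1)!) := by
        gcongr
    _ = 2 * (|(g 1 : ℝ)| + |(g 2 : ℝ)|) / 2 ^ (K + 1)! := by ring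
    _ ≤ 2 * (∑ i, (|g i| : ℝ)) / 2 ^ (K + 1)! := by gcongr

/-- Scale lower bound: a NON-ZERO value `Φ_K = g₀ + g₁ s_K + g₂ t_K` is `≥ 6^{−K!}` (common denominator `6^{K!}`). -/
private theorem form_scale_lower (g : Fin 3 → ℤ) (K : ℕ)
    (hne : (g 0 : ℝ) + g 1 * partialSum 2 K + g 2 * partialSum 3 K ≠ 0) :
    1 / (6 : ℝ) ^ K ! ≤ |(g 0 : ℝ) + g 1 * partialSum 2 K + g 2 * partialSum 3 K| := by
  obtain ⟨p2, hp2⟩ := partialSum_eq_rat (by norm_num : 0 < 2) K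
  obtain ⟨p3, hp3⟩ := partialSum_eq_rat (by norm_num : 0 < 3) K
  push_cast at hp2 hp3
  set I : ℤ := g 0 * 6 ^ K ! + g 1 * p2 * 3 ^ K ! + g 2 * p3 * 2 ^ K ! with hI
  have h6 : (6 : ℝ) ^ K ! = 2 ^ K ! * 3 ^ K ! := by rw [← mul_pow]; norm_num
  have hΦ : (g 0 : ℝ) + g 1 * partialSum 2 K + g 2 * partialSum 3 K = (I : ℝ) / 6 ^ K ! := by
    rw [hp2, hp3, hI]
    push_cast
    rw [h6]
    field_simp
  rw [hΦ] at hne ⊢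
  have hI0 : I ≠ 0 := by
    intro h0; apply hne; rw [h0]; simp
  have hI1 : (1 : ℝ) ≤ |(I : ℝ)| := by exact_mod_cast Int.one_le_abs hI0
  rw [abs_div, abs_of_pos (by positivity : (0 : ℝ) < 6 ^ K !)]
  exact div_le_div_of_nonneg_right hI1 (by positivity)

/-- **Two scales:** if `Φ_N = Φ_{N+1} = 0` then `g₁ 3^{(N+1)!} + g₂ 2^{(N+1)!} = 0`, so `2^{(N+1)!} ∣ g₁`
(coprimality), hence `g₁ = g₂ = 0` once `|g₁| < 2^{(N+1)!}`. -/
private theorem form_two_scale (g : Fin 3 → ℤ) (N : ℕ)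
    (h0 : (g 0 : ℝ) + g 1 * partialSum 2 N + g 2 * partialSum 3 N = 0)
    (h1 : (g 0 : ℝ) + g 1 * partialSum 2 (N + 1) + g 2 * partialSum 3 (N + 1) = 0)
    (hsmall : |g 1| < (2 : ℤ) ^ (N + 1)!) : g 1 = 0 ∧ g 2 = 0 := by
  rw [partialSum_succ, partialSum_succ] at h1
  have hd : (g 1 : ℝ) / 2 ^ (N + 1)! + g 2 / 3 ^ (N + 1)! = 0 := by linear_combination h1 - h0
  have hz : (g 1 : ℝ) * 3 ^ (N + 1)! + g 2 * 2 ^ (N + 1)! = 0 := by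
    have h2 : (2 : ℝ) ^ (N + 1)! ≠ 0 := by positivity
    have h3 : (3 : ℝ) ^ (N + 1)! ≠ 0 := by positivity
    field_simp at hd
    linear_combination hd
  have hzZ : g 1 * 3 ^ (N + 1)! + g 2 * 2 ^ (N + 1)! = (0 : ℤ) := by exact_mod_cast hz
  have hdvd : (2 : ℤ) ^ (N + 1)! ∣ g 1 * 3 ^ (N + 1)! := ⟨-(g 2), by linear_combination hzZ⟩
  have hcop : IsCoprime ((2 : ℤ) ^ (N + 1)!) ((3 : ℤ) ^ (N + 1)!) :=
    (show IsCoprime (2 : ℤ) 3 from ⟨-1, 1, by norm_num⟩).pow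
  have hg1 : g 1 = 0 := Int.eq_zero_of_abs_lt_dvd (hcop.dvd_of_dvd_mul_right hdvd) hsmall
  refine ⟨hg1, ?_⟩
  rw [hg1, zero_mul, zero_add] at hzZ
  exact (mul_eq_zero.mp hzZ).resolve_right (pow_ne_zero _ (by norm_num))

set_option maxHeartbeats 800000 in
/-- **THE TWO-SCALE FORM BOUND** (hypothesis-free): every non-zero integer form in `(1, ℓ₂, ℓ₃)` satisfies
`exp(−(1+Σ|gᵢ|)^11) ≤ |g₀ + g₁ℓ₂ + g₂ℓ₃|`.  (Scale `N ≥ 3` least with `4H ≤ 2^{N!}`; at one of the scales `N, N+1`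
the truncated form is non-zero — `form_two_scale` — hence `≥ 6^{−K!}`, twice the approximation error; and
`(N+1)! ≤ 64 (1+H)^3` by minimality.) -/
theorem form_lower_bound_W (g : Fin 3 → ℤ) (hg : g ≠ 0) :
    Real.exp (-((1 + ∑ i, (|g i| : ℝ)) ^ 11)) ≤
      |(g 0 : ℝ) + g 1 * liouvilleNumber 2 + g 2 * liouvilleNumber 3| := by
  classical
  set HR : ℝ := ∑ i, (|g i| : ℝ) with hHR
  have hHR0 : 0 ≤ HR := by
    rw [hHR]; exact Finset.sum_nonneg fun i _ => by exact_mod_cast abs_nonneg (g i)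
  have hexp1 : Real.exp (-((1 + HR) ^ 11)) ≤ 1 := by
    rw [Real.exp_le_one_iff]
    have : (0 : ℝ) ≤ (1 + HR) ^ 11 := by positivity
    linarith
  by_cases h12 : g 1 = 0 ∧ g 2 = 0
  · -- `φ = g₀`, a non-zero integer
    have hg0 : g 0 ≠ 0 := by
      intro h0; apply hg; funext i
      fin_cases i <;> simp [h0, h12.1, h12.2]
    have h1 : (1 : ℝ) ≤ |(g 0 : ℝ) + g 1 * liouvilleNumber 2 + g 2 * liouvilleNumber 3| := by
      simp only [h12.1, h12.2, Int.cast_zero, zero_mul, add_zero]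
      exact_mod_cast Int.one_le_abs hg0
    linarith
  · -- the natural height `Hn` and the scale `N = K₀ + 3`
    set Hn : ℕ := ∑ i, (g i).natAbs with hHn
    have hHRn : HR = (Hn : ℝ) := by
      rw [hHR, hHn, Nat.cast_sum]
      refine Finset.sum_congr rfl fun i _ => ?_
      simp only [Nat.cast_natAbs, Int.cast_abs]
    have hHn1 : 1 ≤ Hn := by
      obtain ⟨i, hi⟩ := Function.ne_iff.mp hg
      have hi' : g i ≠ 0 := by simpa using hi
      have h1 : 1 ≤ (g i).natAbs := Int.natAbs_pos.mpr hi'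
      exact h1.trans (Finset.single_le_sum (f := fun i => (g i).natAbs) (fun _ _ => Nat.zero_le _)
        (Finset.mem_univ i))
    have hex : ∃ K : ℕ, 4 * Hn ≤ 2 ^ (K + 3)! := by
      refine ⟨4 * Hn, (Nat.lt_two_pow_self).le.trans (Nat.pow_le_pow_right (by norm_num) ?_)⟩
      exact (Nat.le_add_right _ _).trans (Nat.self_le_factorial _)
    set K₀ : ℕ := Nat.find hex with hK₀
    have hK₀spec : 4 * Hn ≤ 2 ^ (K₀ + 3)! := Nat.find_spec hex
    set N : ℕ := K₀ + 3 with hN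
    have hN3 : 3 ≤ N := by omega
    have hHN : 4 * Hn ≤ 2 ^ N ! := hK₀spec
    -- `(N+1)! ≤ 64 (1+Hn)^3`
    have hfac : (N + 1)! ≤ 64 * (1 + Hn) ^ 3 := by
      rcases Nat.eq_zero_or_pos K₀ with hz | hpos
      · have h24 : (N + 1)! = 24 := by rw [hN, hz]; rfl
        have h1 : 1 ≤ (1 + Hn) ^ 3 := Nat.one_le_pow _ _ (by omega)
        omega
      · have hmin := Nat.find_min hex (m := K₀ - 1) (by omega)
        rw [show K₀ - 1 + 3 = K₀ + 2 by omega] at hmin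
        have hlt : (K₀ + 2)! < 4 * Hn := (Nat.lt_two_pow_self).trans (not_le.mp hmin)
        have hK2 : K₀ + 2 ≤ (K₀ + 2)! := Nat.self_le_factorial _
        rw [hN, show K₀ + 3 + 1 = (K₀ + 2) + 1 + 1 by omega, Nat.factorial_succ, Nat.factorial_succ]
        have h1 : K₀ + 2 + 1 + 1 ≤ 4 * (1 + Hn) := by omega
        have h2 : K₀ + 2 + 1 ≤ 4 * (1 + Hn) := by omega
        have h3 : (K₀ + 2)! ≤ 4 * (1 + Hn) := by omega
        calc (K₀ + 2 + 1 + 1) * ((K₀ + 2 + 1) * (K₀ + 2)!)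
            ≤ (4 * (1 + Hn)) * ((4 * (1 + Hn)) * (4 * (1 + Hn))) :=
              Nat.mul_le_mul h1 (Nat.mul_le_mul h2 h3)
          _ = 64 * (1 + Hn) ^ 3 := by ring
    have hfacR : (((N + 1)! : ℕ) : ℝ) ≤ 64 * (1 + HR) ^ 3 := by
      rw [hHRn]; exact_mod_cast hfac
    -- `|g₁| < 2^{(N+1)!}`
    have hsmall : |g 1| < (2 : ℤ) ^ (N + 1)! := by
      have h1 : (g 1).natAbs ≤ Hn :=
        Finset.single_le_sum (f := fun i => (g i).natAbs) (fun _ _ => Nat.zero_le _) (Finset.mem_univ 1)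
      have h2 : Hn < 2 ^ N ! := by have := Nat.two_pow_pos (N !); omega
      have h3 : 2 ^ N ! ≤ 2 ^ (N + 1)! := Nat.pow_le_pow_right (by norm_num) (Nat.factorial_le (by omega))
      have h4 : (g 1).natAbs < 2 ^ (N + 1)! := by omega
      have h5 : (((g 1).natAbs : ℕ) : ℤ) < ((2 ^ (N + 1)! : ℕ) : ℤ) := by exact_mod_cast h4
      rwa [Int.natCast_natAbs, Nat.cast_pow, Nat.cast_ofNat] at h5
    -- at a scale `K ∈ {N, N+1}` where the truncated form is non-zero, conclude
    have key : ∀ K, N ≤ K → K ≤ N + 1 →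
        (g 0 : ℝ) + g 1 * partialSum 2 K + g 2 * partialSum 3 K ≠ 0 →
        Real.exp (-((1 + HR) ^ 11)) ≤ |(g 0 : ℝ) + g 1 * liouvilleNumber 2 + g 2 * liouvilleNumber 3| := by
      intro K hNK hKN hne
      have hK3 : 3 ≤ K := hN3.trans hNK
      have hlowK := form_scale_lower g K hne
      have happK := form_approx g K
      rw [← hHR] at happK
      -- separation: `2 · (2H/2^{(K+1)!}) ≤ 1/6^{K!}`
      have hA : 4 * HR ≤ (2 : ℝ) ^ K ! := by
        rw [hHRn]
        have : 4 * Hn ≤ 2 ^ K ! := hHN.trans (Nat.pow_le_pow_right (by norm_num) (Nat.factorial_le hNK))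
        exact_mod_cast this
      have hB : (6 : ℝ) ^ K ! ≤ (2 ^ K) ^ K ! := by
        refine pow_le_pow_left₀ (by norm_num) ?_ _
        calc (6 : ℝ) ≤ 2 ^ 3 := by norm_num
          _ ≤ 2 ^ K := pow_le_pow_right₀ (by norm_num) hK3
      have hB' : ((2 : ℝ) ^ K) ^ K ! = (2 ^ K !) ^ K := by rw [← pow_mul, ← pow_mul, mul_comm]
      have hC : (2 : ℝ) ^ (K + 1)! = 2 ^ K ! * (2 ^ K !) ^ K := by
        rw [Nat.factorial_succ, show (K + 1) * K ! = K ! * (K + 1) by ring, pow_mul, pow_succ]; ring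
      have hsep : 2 * (2 * HR / 2 ^ (K + 1)!) ≤ 1 / (6 : ℝ) ^ K ! := by
        rw [← mul_div_assoc, div_le_div_iff₀ (by positivity) (by positivity), one_mul]
        calc 2 * (2 * HR) * (6 : ℝ) ^ K ! = (4 * HR) * 6 ^ K ! := by ring
          _ ≤ 2 ^ K ! * (2 ^ K) ^ K ! := mul_le_mul hA hB (by positivity) (by positivity)
          _ = 2 ^ K ! * (2 ^ K !) ^ K := by rw [hB']
          _ = 2 ^ (K + 1)! := hC.symm
      -- `|φ| ≥ |Φ_K| − |φ − Φ_K| ≥ (1/6^{K!})/2`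
      have hφK : 1 / (6 : ℝ) ^ K ! / 2 ≤ |(g 0 : ℝ) + g 1 * liouvilleNumber 2 + g 2 * liouvilleNumber 3| := by
        have ht := abs_sub_abs_le_abs_sub ((g 0 : ℝ) + g 1 * partialSum 2 K + g 2 * partialSum 3 K)
          ((g 0 : ℝ) + g 1 * liouvilleNumber 2 + g 2 * liouvilleNumber 3)
        rw [abs_sub_comm] at ht
        linarith
      refine le_trans ?_ hφK
      -- `exp(−(1+H)^11) ≤ (1/6^{K!})/2`: `2·6^{K!} ≤ exp(1 + 2K!) ≤ exp((1+H)^11)`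
      have hKfac : ((K ! : ℕ) : ℝ) ≤ 64 * (1 + HR) ^ 3 := by
        have h1 : K ! ≤ (N + 1)! := Nat.factorial_le hKN
        have h2 : ((K ! : ℕ) : ℝ) ≤ (((N + 1)! : ℕ) : ℝ) := by exact_mod_cast h1
        exact h2.trans hfacR
      have hX1 : (1 : ℝ) ≤ HR := by rw [hHRn]; exact_mod_cast hHn1
      have hX2 : (2 : ℝ) ≤ 1 + HR := by linarith
      have hX3 : (8 : ℝ) ≤ (1 + HR) ^ 3 := by
        have := pow_le_pow_left₀ (by norm_num) hX2 3
        norm_num at this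
        linarith
      have hX8 : (256 : ℝ) ≤ (1 + HR) ^ 8 := by
        have := pow_le_pow_left₀ (by norm_num) hX2 8
        norm_num at this
        linarith
      have hpoly : 1 + 2 * ((K ! : ℕ) : ℝ) ≤ (1 + HR) ^ 11 := by
        have e : (1 + HR) ^ 11 = (1 + HR) ^ 8 * (1 + HR) ^ 3 := by ring
        rw [e]
        nlinarith
      have hexpK : 2 * (6 : ℝ) ^ K ! ≤ Real.exp ((1 + HR) ^ 11) := by
        calc 2 * (6 : ℝ) ^ K ! ≤ Real.exp 1 * Real.exp 2 ^ K ! :=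
              mul_le_mul two_le_exp_one (pow_le_pow_left₀ (by norm_num) six_le_exp_two _)
                (by positivity) (Real.exp_pos _).le
          _ = Real.exp (1 + 2 * ((K ! : ℕ) : ℝ)) := by
              rw [← Real.exp_nat_mul, ← Real.exp_add]; ring_nf
          _ ≤ Real.exp ((1 + HR) ^ 11) := Real.exp_le_exp.mpr hpoly
      rw [Real.exp_neg, div_div, one_div]
      exact inv_anti₀ (by positivity) (by linarith [hexpK])
    by_cases hΦN : (g 0 : ℝ) + g 1 * partialSum 2 N + g 2 * partialSum 3 N = 0
    · have hΦN1 : (g 0 : ℝ) + g 1 * partialSum 2 (N + 1) + g 2 * partialSum 3 (N + 1) ≠ 0 :=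
        fun h1 => h12 (form_two_scale g N hΦN h1 hsmall)
      exact key (N + 1) (Nat.le_succ N) le_rfl hΦN1
    · exact key N le_rfl (Nat.le_succ N) hΦN

end FormBound

end Summit.Schanuel.Schanuel.Theorems.RootDecomp1KTwoBaseCell
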